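import Mathlib
import Summits.Ventures.PercRepro2.CoinOrTailAlg

/-!
# The OR-tail functional for DOMINATING markers, I: the block theorem and the tail-mixed values
(blind cell PercRepro2, night-2 g9 session 2; proofs/NIGHT2-DARC.md §39)

`orTailDom_functional_nonneg` (in `CoinOrTailBlockSums`): the cleared functional of row 2′DARC at an OR-tail
(`rVal`/`gVal` with the tail entries `r` (coin `ρ`) and `q` (coin `τ`)) is nonnegative for ANY two
markers `m₁, m₂ ∈ U` that DOMINATE the entries (`ν`-a.e. `r ∈ W → m₁ ∈ W` and `q ∈ W → m₂ ∈ W`):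
the entries themselves (adjacent markers), one far marker, and BOTH MARKERS FAR ON DIFFERENT
ROUTES — the case no LP certificate of degree 3 covers.

The proof is the BLOCK IDENTITY.  Split the subsets of `U` into the four blocks
`(b₁, b₂) = (1[m₁ ∈ W], 1[m₂ ∈ W])`, `Λ_{b₁b₂} = Σ_block ν·rVal`, `M_{b₁b₂} = Σ_block ν·gVal`.
Then `Φ = Ψ₀₀ + Ψ₁₀ + Ψ₀₁ + Ψ₁₁` (a polynomial identity in the eight block sums, `orTailBlock_identity`),
and with `M₀₀ = Λ₀₀` (the block with neither marker never enters the tail), `M ≤ Λ`,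
`H1 : Λ₁₀Λ₀₁ ≤ Λ₀₀Λ₁₁` and `H2 : M₁₀M₀₁ ≤ Λ₀₀M₁₁` every `Ψ` is a sum of products of
nonnegative differences (`orTailBlock_nonneg`).  `H1, H2` are the Ahlswede–Daykin four functions
theorem on the blocks: the weight `ν` is log-supermodular, the cell weights are `∩/∪`-compatible
(`cellWt_mul_le`), and the tail-mixed values `rVal`/`gVal` are log-supermodular on
ENTRY-DISJOINT pairs (`rVal_mul_le`, `gVal_mul_le`: `q ∉ s`, `r ∉ t`, termwise in the tail
expansion) — and the blocks `(1,0)`, `(0,1)` are entry-disjoint exactly because the markers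
dominate the entries.

This file: the block identity and the block theorem (`orTailBlock_identity`, `orTailBlock_nonneg`) and the
entry-disjoint log-supermodularity of `rVal`/`gVal` (`rVal_mul_le`, `gVal_mul_le`).
-/

namespace Summit.Ventures.PercRepro2.Coin

section BlockAlg

variable {R : Type*} [Field R] [LinearOrder R] [IsStrictOrderedRing R]

omit [LinearOrder R] [IsStrictOrderedRing R] in
/-- **The block identity**: the cleared functional in the eight block sums is the sum of the four
corner polynomials. -/
lemma orTailBlock_identity (L00 L01 L10 L11 M00 M01 M10 M11 : R) :
    (L00 + L01 + L10 + L11) ^ 2 * M11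
        - (L00 + L01 + L10 + L11) * (L10 + L11) * (M01 + M11)
        - (L00 + L01 + L10 + L11) * (L01 + L11) * (M10 + M11)
        + (L10 + L11) * (L01 + L11) * (M00 + M01 + M10 + M11) =
      (L00 ^ 2 * M11 - L00 * L10 * M01 - L00 * L01 * M10 + L10 * L01 * M00)
      + (L10 * L00 * M11 - L10 ^ 2 * M01 - L00 * L11 * M10 + L10 * L11 * M00)
      + (L01 * L00 * M11 - L01 ^ 2 * M10 - L00 * L11 * M01 + L01 * L11 * M00)
      + (L11 ^ 2 * M00 - L11 * L01 * M10 - L11 * L10 * M01 + L01 * L10 * M11) := by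
  ring

/-- **The block theorem.**  Eight block sums with `0 ≤ M ≤ Λ`, `M₀₀ = Λ₀₀`,
`H1 : Λ₁₀Λ₀₁ ≤ Λ₀₀Λ₁₁`, `H2 : M₁₀M₀₁ ≤ Λ₀₀M₁₁`: the cleared functional is nonnegative. -/
theorem orTailBlock_nonneg (L00 L01 L10 L11 M00 M01 M10 M11 : R)
    (hL00 : 0 ≤ L00) (hM01 : 0 ≤ M01) (hM10 : 0 ≤ M10) (hM11 : 0 ≤ M11)
    (h01 : M01 ≤ L01) (h10 : M10 ≤ L10) (h11 : M11 ≤ L11) (h00 : M00 = L00)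
    (H1 : L10 * L01 ≤ L00 * L11) (H2 : M10 * M01 ≤ L00 * M11) :
    0 ≤ (L00 + L01 + L10 + L11) ^ 2 * M11
        - (L00 + L01 + L10 + L11) * (L10 + L11) * (M01 + M11)
        - (L00 + L01 + L10 + L11) * (L01 + L11) * (M10 + M11)
        + (L10 + L11) * (L01 + L11) * (M00 + M01 + M10 + M11) := by
  have h00' : L00 = M00 := h00.symm
  subst h00'
  have hL01 : 0 ≤ L01 := hM01.trans h01
  have hL10 : 0 ≤ L10 := hM10.trans h10
  have hL11 : 0 ≤ L11 := hM11.trans h11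
  have hd10 : 0 ≤ L10 - M10 := sub_nonneg.2 h10
  have hd01 : 0 ≤ L01 - M01 := sub_nonneg.2 h01
  have hH2 : 0 ≤ L00 * M11 - M10 * M01 := sub_nonneg.2 H2
  have hH1a : 0 ≤ L00 * L11 - L10 * M01 := by nlinarith
  have hH1b : 0 ≤ L00 * L11 - L01 * M10 := by nlinarith
  -- the three easy corners
  have hΨ00 : 0 ≤ L00 ^ 2 * M11 - L00 * L10 * M01 - L00 * L01 * M10 + L10 * L01 * L00 := by
    have : L00 ^ 2 * M11 - L00 * L10 * M01 - L00 * L01 * M10 + L10 * L01 * L00 =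
        L00 * ((L10 - M10) * (L01 - M01) + (L00 * M11 - M10 * M01)) := by ring
    rw [this]
    exact mul_nonneg hL00 (add_nonneg (mul_nonneg hd10 hd01) hH2)
  have hΨ10 : 0 ≤ L10 * L00 * M11 - L10 ^ 2 * M01 - L00 * L11 * M10 + L10 * L11 * L00 := by
    have : L10 * L00 * M11 - L10 ^ 2 * M01 - L00 * L11 * M10 + L10 * L11 * L00 =
        L10 * (L00 * M11 - M10 * M01) + (L10 - M10) * (L00 * L11 - L10 * M01) := by ring
    rw [this]
    exact add_nonneg (mul_nonneg hL10 hH2) (mul_nonneg hd10 hH1a)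
  have hΨ01 : 0 ≤ L01 * L00 * M11 - L01 ^ 2 * M10 - L00 * L11 * M01 + L01 * L11 * L00 := by
    have : L01 * L00 * M11 - L01 ^ 2 * M10 - L00 * L11 * M01 + L01 * L11 * L00 =
        L01 * (L00 * M11 - M10 * M01) + (L01 - M01) * (L00 * L11 - L01 * M10) := by ring
    rw [this]
    exact add_nonneg (mul_nonneg hL01 hH2) (mul_nonneg hd01 hH1b)
  -- the hard corner, multiplied by `L00`
  have hΨ11 : 0 ≤ L00 * (L11 ^ 2 * L00 - L11 * L01 * M10 - L11 * L10 * M01 + L01 * L10 * M11) := by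
    have : L00 * (L11 ^ 2 * L00 - L11 * L01 * M10 - L11 * L10 * M01 + L01 * L10 * M11) =
        L01 * L10 * (L00 * M11 - M10 * M01) +
          (L00 * L11 - L01 * M10) * (L00 * L11 - L10 * M01) := by ring
    rw [this]
    exact add_nonneg (mul_nonneg (mul_nonneg hL01 hL10) hH2) (mul_nonneg hH1b hH1a)
  rw [orTailBlock_identity]
  rcases eq_or_lt_of_le hL00 with h0 | hpos
  · -- `L00 = 0`: by `H1`, one of `L10, L01` vanishes and the functional is identically zero
    rw [← h0] at H1 ⊢
    have hprod : L10 * L01 = 0 := le_antisymm (by simpa using H1) (mul_nonneg hL10 hL01)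
    rcases mul_eq_zero.1 hprod with h | h
    · have hM : M10 = 0 := le_antisymm (h ▸ h10) hM10
      rw [h, hM]
      nlinarith
    · have hM : M01 = 0 := le_antisymm (h ▸ h01) hM01
      rw [h, hM]
      nlinarith
  · have hsum : 0 ≤ L00 * ((L00 ^ 2 * M11 - L00 * L10 * M01 - L00 * L01 * M10 + L10 * L01 * L00)
        + (L10 * L00 * M11 - L10 ^ 2 * M01 - L00 * L11 * M10 + L10 * L11 * L00)
        + (L01 * L00 * M11 - L01 ^ 2 * M10 - L00 * L11 * M01 + L01 * L11 * L00)
        + (L11 ^ 2 * L00 - L11 * L01 * M10 - L11 * L10 * M01 + L01 * L10 * M11)) := by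
      have := add_nonneg (mul_nonneg hL00 (add_nonneg (add_nonneg hΨ00 hΨ10) hΨ01)) hΨ11
      linarith [this]
    exact le_of_mul_le_mul_left (by simpa using hsum) hpos

end BlockAlg

section BlockCells

variable {V : Type*} [DecidableEq V] {R : Type*} [Field R] [LinearOrder R] [IsStrictOrderedRing R]

omit [LinearOrder R] [IsStrictOrderedRing R] in
/-- The tail weight of a set without entries is `1`. -/
lemma tailWt_eq_one {r q : V} {ρ τ : R} {W : Finset V} (hr : r ∉ W) (hq : q ∉ W) :
    tailWt r q ρ τ W = 1 := by
  simp [tailWt, hr, hq]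

omit [LinearOrder R] [IsStrictOrderedRing R] in
/-- The tail weight of a union of entry-disjoint sets is the product of the tail weights. -/
lemma tailWt_union {r q : V} {ρ τ : R} {s t : Finset V} (hqs : q ∉ s) (hrt : r ∉ t) :
    tailWt r q ρ τ (s ∪ t) = tailWt r q ρ τ s * tailWt r q ρ τ t := by
  by_cases hr : r ∈ s <;> by_cases hq : q ∈ t <;> simp [tailWt, Finset.mem_union, hr, hq, hqs, hrt]

/-- `0 ≤ tailWt`. -/
lemma tailWt_nonneg {r q : V} {ρ τ : R} (hρ1 : ρ ≤ 1) (hτ1 : τ ≤ 1) (W : Finset V) :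
    0 ≤ tailWt r q ρ τ W := by
  unfold tailWt
  apply mul_nonneg
  · split_ifs
    · linarith [hρ1]
    · simp
  · split_ifs
    · linarith [hτ1]
    · simp

/-- `tailWt ≤ 1`. -/
lemma tailWt_le_one {r q : V} {ρ τ : R} (hρ0 : 0 ≤ ρ) (hτ0 : 0 ≤ τ) (hτ1 : τ ≤ 1)
    (W : Finset V) : tailWt r q ρ τ W ≤ 1 := by
  unfold tailWt
  split_ifs
  · nlinarith [mul_nonneg hρ0 (sub_nonneg.2 hτ1), hτ0]
  · nlinarith [hρ0]
  · nlinarith [hτ0]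
  · simp

omit [LinearOrder R] [IsStrictOrderedRing R] in
/-- The value of a set without entries is its head value. -/
lemma rVal_of_no_entry {A : Finset V → R} {r q a : V} {ρ τ : R} {W : Finset V}
    (hr : r ∉ W) (hq : q ∉ W) : rVal A r q a ρ τ W = A W := by
  simp [rVal, tailWt_eq_one hr hq]

omit [LinearOrder R] [IsStrictOrderedRing R] in
/-- The gate value of a set without entries is its head value. -/
lemma gVal_of_no_entry {A : Finset V → R} {r q a w : V} {ρ τ : R} {W : Finset V}
    (hr : r ∉ W) (hq : q ∉ W) : gVal A r q a w ρ τ W = A W := by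
  simp [gVal, tailWt_eq_one hr hq]

/-- The gate value is at most the `R`-value. -/
lemma gVal_le_rVal {A : Finset V → R} {r q a w : V} {ρ τ : R}
    (hρ0 : 0 ≤ ρ) (hτ0 : 0 ≤ τ) (hτ1 : τ ≤ 1)
    (hAmono : ∀ s t : Finset V, s ⊆ t → A t ≤ A s) (W : Finset V) :
    gVal A r q a w ρ τ W ≤ rVal A r q a ρ τ W := by
  unfold gVal rVal
  have h1 := tailWt_le_one (r := r) (q := q) hρ0 hτ0 hτ1 W
  have h2 : A (W ∪ {a, w}) ≤ A (W ∪ {a}) := by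
    apply hAmono
    apply Finset.union_subset_union_right
    intro x hx
    simp only [Finset.mem_singleton] at hx
    simp [hx]
  nlinarith

/-- The gate value is nonnegative. -/
lemma gVal_nonneg {A : Finset V → R} {r q a w : V} {ρ τ : R}
    (hρ0 : 0 ≤ ρ) (hρ1 : ρ ≤ 1) (hτ0 : 0 ≤ τ) (hτ1 : τ ≤ 1) (hA0 : ∀ W, 0 ≤ A W)
    (W : Finset V) : 0 ≤ gVal A r q a w ρ τ W := by
  unfold gVal
  have h1 := tailWt_le_one (r := r) (q := q) hρ0 hτ0 hτ1 W
  have h2 := tailWt_nonneg (r := r) (q := q) hρ1 hτ1 W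
  have := hA0 W; have := hA0 (W ∪ {a, w})
  nlinarith

omit [LinearOrder R] [IsStrictOrderedRing R] in
/-- `s ∩ (t ∪ X) = s ∩ t` when `s` avoids `X`. -/
lemma inter_union_of_disjoint_right {s t X : Finset V} (h : Disjoint s X) :
    s ∩ (t ∪ X) = s ∩ t := by
  rw [Finset.inter_union_distrib_left, Finset.disjoint_iff_inter_eq_empty.1 h, Finset.union_empty]

omit [LinearOrder R] [IsStrictOrderedRing R] in
/-- `(s ∪ X) ∩ t = s ∩ t` when `t` avoids `X`. -/
lemma union_inter_of_disjoint_left {s t X : Finset V} (h : Disjoint t X) :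
    (s ∪ X) ∩ t = s ∩ t := by
  rw [Finset.inter_comm, inter_union_of_disjoint_right h, Finset.inter_comm]

omit [LinearOrder R] [IsStrictOrderedRing R] in
/-- `(s ∪ X) ∩ (t ∪ X) = (s ∩ t) ∪ X`. -/
lemma union_inter_union_same {s t X : Finset V} : (s ∪ X) ∩ (t ∪ X) = (s ∩ t) ∪ X := by
  ext x; simp only [Finset.mem_inter, Finset.mem_union]; tauto

omit [LinearOrder R] [IsStrictOrderedRing R] in
/-- `(s ∪ X) ∪ t = (s ∪ t) ∪ X`. -/
lemma union_union_right_comm {s t X : Finset V} : (s ∪ X) ∪ t = (s ∪ t) ∪ X := by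
  ext x; simp only [Finset.mem_union]; tauto

omit [LinearOrder R] [IsStrictOrderedRing R] in
/-- `s ∪ (t ∪ X) = (s ∪ t) ∪ X`. -/
lemma union_union_left_assoc {s t X : Finset V} : s ∪ (t ∪ X) = (s ∪ t) ∪ X := by
  ext x; simp only [Finset.mem_union]; tauto

omit [LinearOrder R] [IsStrictOrderedRing R] in
/-- `(s ∪ X) ∪ (t ∪ X) = (s ∪ t) ∪ X`. -/
lemma union_union_union_same {s t X : Finset V} : (s ∪ X) ∪ (t ∪ X) = (s ∪ t) ∪ X := by
  ext x; simp only [Finset.mem_union]; tauto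

/-- **Mixed log-supermodularity of the tail-mixed values on ENTRY-DISJOINT pairs**: for
`s ∌ q`, `t ∌ r` (both avoiding the phantom set `X ∌ r, q` that the tail adds),
`v s · v t ≤ v (s ∩ t) · v (s ∪ t)` where `v W = tailWt W · A W + (1 − tailWt W) · A (W ∪ X)`.
Termwise in the tail expansion: each of the four products is log-supermodular (`hA`), the
`A(s ∪ X)·A(t ∪ X)` term after a monotone step. -/
lemma mixVal_mul_le {A : Finset V → R} {r q : V} {ρ τ : R} {X s t : Finset V}
    (hρ0 : 0 ≤ ρ) (hρ1 : ρ ≤ 1) (hτ0 : 0 ≤ τ) (hτ1 : τ ≤ 1)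
    (hA0 : ∀ W, 0 ≤ A W) (hA : ∀ s t : Finset V, A s * A t ≤ A (s ∩ t) * A (s ∪ t))
    (hAmono : ∀ s t : Finset V, s ⊆ t → A t ≤ A s)
    (hsX : Disjoint s X) (htX : Disjoint t X) (hqs : q ∉ s) (hrt : r ∉ t) :
    (tailWt r q ρ τ s * A s + (1 - tailWt r q ρ τ s) * A (s ∪ X)) *
        (tailWt r q ρ τ t * A t + (1 - tailWt r q ρ τ t) * A (t ∪ X)) ≤
      A (s ∩ t) *
        (tailWt r q ρ τ (s ∪ t) * A (s ∪ t) + (1 - tailWt r q ρ τ (s ∪ t)) * A ((s ∪ t) ∪ X)) := by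
  rw [tailWt_union hqs hrt]
  set x := tailWt r q ρ τ s with hx
  set y := tailWt r q ρ τ t with hy
  have hx0 : 0 ≤ x := tailWt_nonneg hρ1 hτ1 s
  have hx1 : x ≤ 1 := tailWt_le_one hρ0 hτ0 hτ1 s
  have hy0 : 0 ≤ y := tailWt_nonneg hρ1 hτ1 t
  have hy1 : y ≤ 1 := tailWt_le_one hρ0 hτ0 hτ1 t
  -- the four termwise inequalities
  have e1 : A s * A t ≤ A (s ∩ t) * A (s ∪ t) := hA s t
  have e2 : A s * A (t ∪ X) ≤ A (s ∩ t) * A ((s ∪ t) ∪ X) := by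
    have := hA s (t ∪ X)
    rwa [inter_union_of_disjoint_right hsX, union_union_left_assoc] at this
  have e3 : A (s ∪ X) * A t ≤ A (s ∩ t) * A ((s ∪ t) ∪ X) := by
    have := hA (s ∪ X) t
    rwa [union_inter_of_disjoint_left htX, union_union_right_comm] at this
  have e4 : A (s ∪ X) * A (t ∪ X) ≤ A (s ∩ t) * A ((s ∪ t) ∪ X) := by
    have := hA (s ∪ X) (t ∪ X)
    rw [union_inter_union_same, union_union_union_same] at this
    refine this.trans ?_
    exact mul_le_mul_of_nonneg_right (hAmono _ _ Finset.subset_union_left) (hA0 _)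
  have c1 : 0 ≤ x * y := mul_nonneg hx0 hy0
  have c2 : 0 ≤ x * (1 - y) := mul_nonneg hx0 (sub_nonneg.2 hy1)
  have c3 : 0 ≤ (1 - x) * y := mul_nonneg (sub_nonneg.2 hx1) hy0
  have c4 : 0 ≤ (1 - x) * (1 - y) := mul_nonneg (sub_nonneg.2 hx1) (sub_nonneg.2 hy1)
  have f1 := mul_le_mul_of_nonneg_left e1 c1
  have f2 := mul_le_mul_of_nonneg_left e2 c2
  have f3 := mul_le_mul_of_nonneg_left e3 c3
  have f4 := mul_le_mul_of_nonneg_left e4 c4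
  nlinarith [f1, f2, f3, f4]

/-- `rVal` is log-supermodular on entry-disjoint pairs (`s ∌ q`, `t ∌ r`, `a ∉ s ∪ t`). -/
lemma rVal_mul_le {A : Finset V → R} {r q a : V} {ρ τ : R} {s t : Finset V}
    (hρ0 : 0 ≤ ρ) (hρ1 : ρ ≤ 1) (hτ0 : 0 ≤ τ) (hτ1 : τ ≤ 1)
    (hA0 : ∀ W, 0 ≤ A W) (hA : ∀ s t : Finset V, A s * A t ≤ A (s ∩ t) * A (s ∪ t))
    (hAmono : ∀ s t : Finset V, s ⊆ t → A t ≤ A s)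
    (has : a ∉ s) (hat : a ∉ t) (hqs : q ∉ s) (hrt : r ∉ t) :
    rVal A r q a ρ τ s * rVal A r q a ρ τ t ≤
      rVal A r q a ρ τ (s ∩ t) * rVal A r q a ρ τ (s ∪ t) := by
  have hrst : r ∉ s ∩ t := fun h => hrt (Finset.mem_inter.1 h).2
  have hqst : q ∉ s ∩ t := fun h => hqs (Finset.mem_inter.1 h).1
  rw [rVal_of_no_entry hrst hqst]
  unfold rVal
  exact mixVal_mul_le hρ0 hρ1 hτ0 hτ1 hA0 hA hAmono (Finset.disjoint_singleton_right.2 has)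
    (Finset.disjoint_singleton_right.2 hat) hqs hrt

/-- `gVal` is log-supermodular on entry-disjoint pairs (`s ∌ q`, `t ∌ r`, `a, w ∉ s ∪ t`). -/
lemma gVal_mul_le {A : Finset V → R} {r q a w : V} {ρ τ : R} {s t : Finset V}
    (hρ0 : 0 ≤ ρ) (hρ1 : ρ ≤ 1) (hτ0 : 0 ≤ τ) (hτ1 : τ ≤ 1)
    (hA0 : ∀ W, 0 ≤ A W) (hA : ∀ s t : Finset V, A s * A t ≤ A (s ∩ t) * A (s ∪ t))
    (hAmono : ∀ s t : Finset V, s ⊆ t → A t ≤ A s)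
    (has : a ∉ s) (hat : a ∉ t) (hws : w ∉ s) (hwt : w ∉ t) (hqs : q ∉ s) (hrt : r ∉ t) :
    gVal A r q a w ρ τ s * gVal A r q a w ρ τ t ≤
      gVal A r q a w ρ τ (s ∩ t) * gVal A r q a w ρ τ (s ∪ t) := by
  have hrst : r ∉ s ∩ t := fun h => hrt (Finset.mem_inter.1 h).2
  have hqst : q ∉ s ∩ t := fun h => hqs (Finset.mem_inter.1 h).1
  rw [gVal_of_no_entry hrst hqst]
  unfold gVal
  have hsX : Disjoint s {a, w} := by
    rw [Finset.disjoint_left]; intro x hx hx'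
    simp only [Finset.mem_insert, Finset.mem_singleton] at hx'
    rcases hx' with rfl | rfl; exact has hx; exact hws hx
  have htX : Disjoint t {a, w} := by
    rw [Finset.disjoint_left]; intro x hx hx'
    simp only [Finset.mem_insert, Finset.mem_singleton] at hx'
    rcases hx' with rfl | rfl; exact hat hx; exact hwt hx
  exact mixVal_mul_le hρ0 hρ1 hτ0 hτ1 hA0 hA hAmono hsX htX hqs hrt

end BlockCells

end Summit.Ventures.PercRepro2.Coin
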